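import Mathlib.Data.Nat.Prime.Basic
import Literature.AlgebraicGeometry.Frobenioids.ModelFrobenioidBirat
import Literature.AlgebraicGeometry.Frobenioids.ModelFrobenioidAutDescent
import Literature.AnabelianGeometry.EtaleTheta.TemperedFrobenioidCor38SubPreStepsPowerObstruction
import HarnessLib

/-!
# [EtTh] Cor. 3.8 proof row C38-L02a `PreservesPreSteps` (F-2809): the DEGREE HALF holds for EVERY record —
# `Ψ` of a pre-step is LINEAR, with no hypothesis; hence the row over discrete / FSM-type bases unconditionally

S. Mochizuki, *The étale theta function and its Frobenioid-theoretic manifestations*, Publ. RIMS **45** (2009)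
[EtTh], Cor. 3.8 proof, PDF p. 81 l. 2–3 ("by [Mzk17], Theorem 3.4, (ii) … it follows that `Ψ` preserves
pre-steps") [cite: MochizukiEtTh2009, Cor 3.8 p.81]; S. Mochizuki, *The geometry of Frobenioids I*, Kyushu J.
Math. **62** (2008) [FrdI], §0 p. 17 (irreducible morphisms: "a non-isomorphism `φ` such that in every
factorisation `φ = α ∘ β` one of `α`, `β` is an isomorphism"; "any equivalence of categories manifestly preserves
irreducible morphisms", p. 63), Def. 1.2 (iii) p. 22 (pre-steps = linear base-isomorphisms), Thm. 5.2 (i)–(ii)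
pp. 100–101 (model Frobenioids; the pure Frobenius morphisms `(d, id, 0, 0)`) [cite: MochizukiFrdI2008, §0 p.17].

abc-iut cell, block C / F, seat abc-iut-f-151 (gen 8), row KEY-F2809 «discharge the hypotheses of
`preservesPreSteps_of_preservesLinear_of_isDiscrete`».  PROOF-ONLY companion (0 definitions) of abc-iut-w5-d124's
sub-DAG `TemperedFrobenioidCor38Sub.lean`, row C38-L02a = `Cor38Hyp.PreservesPreSteps` (FACT-LIST F-2809; decision of
record abc-iut-f-032 g7 «undecided-as-typed»; residual door of abc-iut-w6-d040 g5: "move a partner-less pre-step either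
to `F_e ≫ linear`, `e ≥ 2`, `B₂` `e`-divisible, or to a linear arrow over a non-invertible fiberwise-surjective base
arrow").  THIS FILE CLOSES THE FIRST DOOR FOR ALL TYPED DATA: the degree of the image of a pre-step NEVER moves.

THE ARGUMENT (no [FrdI] Thm. 3.4 input, no Frobenioid axiom, no unit / power obstruction, no partner, no use of
`h.fsmff` or of the non-dilating clauses; only: `D_i` totally epimorphic and `B_i` group-like, both Def. 3.6 (i)/(ii)).
(1) In ANY model Frobenioid over a totally epimorphic base with group-like `B`, the pure Frobenius morphism
`F_p = (p, id, 0, 0)` of PRIME degree is IRREDUCIBLE (`ModelFrobenioid.isIrreducibleHom_powUnitHom`): in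
`β ≫ α = F_p` the base arrows compose to `id` (split mono + epi ⇒ both invertible), the zero divisors satisfy
`Base(β)^*Div(α)·Div(β)^{deg α} = 0` (both units), and `deg α · deg β = p` makes one factor a linear base-isomorphism
with unit zero divisor, i.e. an isomorphism (abc-iut's `ModelFrobenioid.isIso_of_isUnit_div`).
(2) In ANY model Frobenioid, the zero divisor of an IRREDUCIBLE arrow is never `W·x^n` with `n ≥ 2` and `x` a
non-unit (`ModelFrobenioid.isUnit_of_isIrreducibleHom_of_div_eq`): a linear arrow `(1, f, Z₁Z₂, u)` splits as
`(1, id, Z₁, 0) ≫ (1, f, Z₂, u)`, and an arrow of degree `d ≥ 2` is `F_d ≫ (1, f, Z, u)`.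
(3) Let `e : C₁ ⥲ C₂` be any equivalence and `φ` a pre-step of `C₁` with `p | deg_Fr(e φ)` prime.  Frobenius
factorisation `e φ = F_p ≫ ρ'` pulls back to `φ = ψ ≫ ρ` with `e ψ = F_p ≫ (iso)`; so `ψ` is a left factor of a
pre-step, hence a pre-step (`D₁` totally epimorphic, abc-iut-w6-d040), and irreducible (equivalences reflect
irreducibility); not being an isomorphism, its zero divisor `x := Div(ψ)` is NOT a unit.  The naturality square
of `F_p` at `e(F_2^X)` ([FrdI] Prop. 2.1 (i), abc-iut-L6-t10's `powUnitHom_comp_powHom`) pulls back to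
`F_2^X ≫ ι = ψ ≫ κ'` in `C₁` with `ι` irreducible (same reason); degrees give `deg κ' = 2·deg ι ≥ 2` and zero divisors
give `Div(ι) = Base(ψ)^*Div(κ') · x^{deg κ'}` — contradicting (2).  Hence
**`TemperedFrobenioid.isLinear_map_of_isPreStep`**: `e φ` is LINEAR, for every `e` and every pre-step `φ`;
**`Cor38Hyp.isLinear_map_of_isPreStep`** / **`…_inverse_map_…`** for every record `h : Cor38Hyp C₁ C₂`.
(4) CLOSERS with the degree hypothesis GONE: `Cor38Hyp.preservesPreSteps_of_isIso_of_isFiberwiseSurjective`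
(abc-iut-w6-d057's closer minus F-2815), **`Cor38Hyp.preservesPreSteps_of_isDiscrete`** — ROW F-2809 FOR EVERY RECORD
OVER DISCRETE BASES (every `Discrete PUnit`-based datum of the tree, all `Ψ` at once) —,
`Cor38Hyp.preservesPreSteps_of_subsingleton_of_mono` (one-object bases with monic arrows, uses `h.fsmff`),
`Cor38Hyp.preservesPreSteps_of_isOfFSMType` (FSM-type bases, cancellative `Φ`; abc-iut-w6-d040's closer minus the power
obstruction).  READING (cell rule R5; the FACT-LIST label is decided on the list, not here): the bare closure of
`PreservesPreSteps` is now exactly its BASE half — a separating record must send a pre-step to a LINEAR arrow over a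
fiberwise-surjective NON-isomorphism of an FSMFF-type `D₂` (abc-iut-f-032's `ConeTwist` mechanism, excluded there only
by `fsmff`); consistent with `AffDil.preservesPreSteps_hyp` (the F-2815 swap moves degrees of NON-pre-steps only).
HONEST FRAMING: bookkeeping about OUR typed Def. 3.6 interface (print's Cor. 3.8 quotes [FrdI] Thm. 3.4 (ii) for
genuine Frobenioids); proved-as-typed ≠ proved-in-print; nothing here bears on [IUTchIII] Cor. 3.12; no side taken;
a FACT row is an assumption label; typed ≠ proved.
-/

namespace Literature.AlgebraicGeometry.Frobenioids

open CategoryTheory Opposite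

universe w v u

/-! ## §0 Irreducible arrows: composition with isomorphisms, reflection along fully faithful functors -/

section Irr

variable {C : Type u} [Category.{v} C]

/-- An irreducible arrow followed by an isomorphism is irreducible. [cite: MochizukiFrdI2008, §0 p.17] -/
theorem IsIrreducibleHom.comp_isIso_right {A B B' : C} {f : A ⟶ B} (hf : IsIrreducibleHom f) (j : B ⟶ B')
    [IsIso j] : IsIrreducibleHom (f ≫ j) := by
  refine ⟨fun h => hf.1 (IsIso.of_isIso_comp_right f j), fun X β α hβα => ?_⟩
  have hfac : β ≫ (α ≫ inv j) = f := by
    rw [← Category.assoc, hβα, Category.assoc, IsIso.hom_inv_id, Category.comp_id]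
  rcases hf.2 β (α ≫ inv j) hfac with hα | hβ
  · exact Or.inl (IsIso.of_isIso_comp_right α (inv j))
  · exact Or.inr hβ

/-- A fully faithful functor REFLECTS irreducibility. [cite: MochizukiFrdI2008, §0 p.17] -/
theorem IsIrreducibleHom.of_map {C' : Type*} [Category C'] (F : C ⥤ C') [F.Full] [F.Faithful] {A B : C}
    {f : A ⟶ B} (h : IsIrreducibleHom (F.map f)) : IsIrreducibleHom f := by
  refine ⟨fun hf => h.1 inferInstance, fun X β α hβα => ?_⟩
  rcases h.2 (F.map β) (F.map α) (by rw [← F.map_comp, hβα]) with hα | hβ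
  · exact Or.inl (isIso_of_fully_faithful F α)
  · exact Or.inr (isIso_of_fully_faithful F β)

end Irr

/-! ## §1 Model Frobenioids: zero divisors of irreducible arrows; pure Frobenius arrows of prime degree -/

namespace ModelFrobenioid

variable {D : Type u} [Category.{v} D] {Φ B : Dᵒᵖ ⥤ CommMonCat.{w}} {DivB : B ⟶ monoidGp Φ}

/-- The zero divisor of an isomorphism of a model Frobenioid is a unit of `Φ(A_D)` (no sharpness assumed).
[cite: MochizukiFrdI2008, Thm. 5.2(ii) p.101] -/
theorem isUnit_div_of_isIso {X Y : ModelFrobenioid Φ B DivB} (φ : X ⟶ Y) [IsIso φ] : IsUnit (div φ) :=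
  ElemFrobenioid.isUnit_div_of_isIso ((toElem Φ B DivB).map φ)

/-- **Frobenius factorisation through a chosen divisor of the degree**: `φ = (p·q, f, Z, u)` factors as the pure
Frobenius morphism `(p, id, 0, 0)` followed by `(q, f, Z, u)`. [cite: MochizukiFrdI2008, Def. 1.3 (iv) p.24] -/
theorem exists_powUnitHom_comp_eq_of_eq_mul {X Y : ModelFrobenioid Φ B DivB} (φ : X ⟶ Y) {p q : ℕ+}
    (h : degFr φ = p * q) :
    ∃ L : powObj Φ B DivB p X ⟶ Y, degFr L = q ∧ powUnitHom Φ B DivB p X ≫ L = φ := by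
  let L : powObj Φ B DivB p X ⟶ Y :=
    { degFr := q
      base := baseMap (X := X) (Y := Y) φ
      div := div (X := X) (Y := Y) φ
      unit := unit (X := X) (Y := Y) φ
      rel := by
        change (X.cls ^ (p : ℕ)) ^ (q : ℕ) * Algebra.GrothendieckGroup.of (div φ) =
          pullGp Φ (baseMap φ) Y.cls * divB Φ B DivB (op X.base) (unit φ)
        rw [← pow_mul, ← PNat.mul_coe, ← h]
        exact rel φ }
  refine ⟨L, rfl, hom_ext (by change q * p = degFr φ; rw [h, mul_comm]) (Category.id_comp _) ?_ ?_⟩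
  · change pull Φ (𝟙 X.base) (div φ) * 1 ^ (q : ℕ) = div φ
    rw [pull_id, one_pow, mul_one]
  · change pull B (𝟙 X.base) (unit φ) * 1 ^ (q : ℕ) = unit φ
    rw [pull_id, one_pow, mul_one]

/-- **Splitting a LINEAR arrow along a factorisation of its zero divisor**: if `ι = (1, f, Z₁·Z₂, u)` is irreducible
then `Z₁` or `Z₂` is a unit — for `ι = (1, id, Z₁, 0) ≫ (1, f, Z₂, u)` through `(A_D, α + Z₁)`, and an isomorphism has a
unit zero divisor. [cite: MochizukiFrdI2008, §0 p.17] -/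
theorem isUnit_or_isUnit_of_isIrreducibleHom {T T' : ModelFrobenioid Φ B DivB} {ι : T ⟶ T'}
    (hι : IsIrreducibleHom ι) (hd : degFr ι = 1) {Z₁ Z₂ : (Φ.obj (op T.base) : Type w)}
    (hZ : div ι = Z₁ * Z₂) : IsUnit Z₁ ∨ IsUnit Z₂ := by
  let T₁ : ModelFrobenioid Φ B DivB := ⟨T.base, T.cls * Algebra.GrothendieckGroup.of Z₁⟩
  let δ : T ⟶ T₁ := mkHom T T₁ 1 (𝟙 T.base) Z₁ 1 (by
    change T.cls ^ ((1 : ℕ+) : ℕ) * Algebra.GrothendieckGroup.of Z₁ =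
      pullGp Φ (𝟙 T.base) (T.cls * Algebra.GrothendieckGroup.of Z₁) * divB Φ B DivB (op T.base) 1
    rw [PNat.one_coe, pow_one, pullGp_id, map_one, mul_one])
  let ι₂ : T₁ ⟶ T' := mkHom T₁ T' 1 (baseMap (X := T) (Y := T') ι) Z₂ (unit (X := T) (Y := T') ι) (by
    change (T.cls * Algebra.GrothendieckGroup.of Z₁) ^ ((1 : ℕ+) : ℕ) * Algebra.GrothendieckGroup.of Z₂ =
      pullGp Φ (baseMap ι) T'.cls * divB Φ B DivB (op T.base) (unit ι)
    have h := rel ι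
    rw [hd, hZ, PNat.one_coe, pow_one, map_mul, ← mul_assoc] at h
    rwa [PNat.one_coe, pow_one])
  have hfac : δ ≫ ι₂ = ι := by
    refine hom_ext (by change (1 : ℕ+) * 1 = degFr ι; rw [hd, mul_one]) (Category.id_comp _) ?_ ?_
    · change pull Φ (𝟙 T.base) Z₂ * Z₁ ^ ((1 : ℕ+) : ℕ) = div ι
      rw [pull_id, PNat.one_coe, pow_one, hZ, mul_comm]
    · change pull B (𝟙 T.base) (unit ι) * 1 ^ ((1 : ℕ+) : ℕ) = unit ι
      rw [pull_id, one_pow, mul_one]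
  exact (hι.2 δ ι₂ hfac).symm.imp (fun h => @isUnit_div_of_isIso _ _ _ _ _ _ _ δ h)
    (fun h => @isUnit_div_of_isIso _ _ _ _ _ _ _ ι₂ h)

/-- **The zero divisor of an IRREDUCIBLE arrow of a model Frobenioid is never of the form `W·x^n` with `n ≥ 2`
and `x` a non-unit**: a linear irreducible arrow splits along `(W·x^{n-1})·x`; an irreducible arrow of degree
`d ≥ 2` is the pure Frobenius `(d, id, 0, 0)` followed by an isomorphism, so its zero divisor is a unit.
[cite: MochizukiFrdI2008, §0 p.17] -/
theorem isUnit_of_isIrreducibleHom_of_div_eq {T T' : ModelFrobenioid Φ B DivB} {ι : T ⟶ T'}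
    (hι : IsIrreducibleHom ι) {W x : (Φ.obj (op T.base) : Type w)} {n : ℕ} (hn : 2 ≤ n)
    (hdiv : div ι = W * x ^ n) : IsUnit x := by
  by_cases hd : degFr ι = 1
  · have hsplit : div ι = (W * x ^ (n - 1)) * x := by
      rw [hdiv, mul_assoc, ← pow_succ, Nat.sub_add_cancel (by omega)]
    exact (isUnit_or_isUnit_of_isIrreducibleHom hι hd hsplit).elim
      (fun h => (isUnit_pow_iff (show n - 1 ≠ 0 by omega)).mp (isUnit_of_mul_isUnit_right h)) id
  · obtain ⟨L, -, hL⟩ := exists_powUnitHom_comp_eq ι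
    rcases hι.2 _ L hL with hLiso | hFiso
    · have hu : IsUnit (div L) := isUnit_div_of_isIso L
      have hdivL := congrArg div hL
      change pull Φ (𝟙 T.base) (div L :) * 1 ^ (degFr L : ℕ) = div ι at hdivL
      rw [pull_id, one_pow, mul_one] at hdivL
      have hu' : IsUnit (W * x ^ n) := by rw [← hdiv, ← hdivL]; exact hu
      exact (isUnit_pow_iff (show n ≠ 0 by omega)).mp (isUnit_of_mul_isUnit_right hu')
    · exact absurd (degFr_eq_one_of_isIso (powUnitHom Φ B DivB (degFr ι) T)) hd

/-- **A pure Frobenius morphism `(p, id, 0, 0)` of PRIME degree is IRREDUCIBLE** over a totally epimorphic base with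
group-like `B`: in a factorisation `β ≫ α = F_p` the base arrows compose to the identity, so (split mono + epi) both
are isomorphisms; the zero divisors satisfy `Base(β)^* Div(α) · Div(β)^{deg α} = 0`, so both are units; and
`deg α · deg β = p` forces one degree to be `1` — that factor is an isomorphism. [cite: MochizukiFrdI2008, Thm. 5.2 (ii) p.101] -/
theorem isIrreducibleHom_powUnitHom (hB : ∀ (A : Dᵒᵖ) (b : (B.obj A : Type w)), IsUnit b)
    (hD : IsTotallyEpimorphic D) (X : ModelFrobenioid Φ B DivB) {p : ℕ+} (hp : (p : ℕ).Prime) :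
    IsIrreducibleHom (powUnitHom Φ B DivB p X) := by
  refine ⟨fun h => hp.ne_one ?_, fun M β α hβα => ?_⟩
  · rw [show p = 1 from degFr_eq_one_of_isIso (powUnitHom Φ B DivB p X)]; rfl
  · have hdeg : degFr α * degFr β = p := congrArg degFr hβα
    have hbase : baseMap β ≫ baseMap (X := M) (Y := powObj Φ B DivB p X) α = 𝟙 X.base :=
      congrArg baseMap hβα
    have hdiv : pull Φ (baseMap β) (div α) * div β ^ (degFr α : ℕ) = 1 := congrArg div hβα
    haveI : IsSplitMono (baseMap β) := IsSplitMono.mk' ⟨(baseMap α :), hbase⟩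
    haveI : Epi (baseMap β) := hD.epi _
    haveI : IsIso (baseMap β) := isIso_of_epi_of_isSplitMono _
    haveI : IsIso (baseMap β ≫ baseMap (X := M) (Y := powObj Φ B DivB p X) α) := by
      rw [hbase]
      exact IsIso.id _
    haveI : IsIso (baseMap (X := M) (Y := powObj Φ B DivB p X) α) :=
      IsIso.of_isIso_comp_left (baseMap β) _
    have hP : IsUnit (pull Φ (baseMap β) (div α)) := IsUnit.of_mul_eq_one _ hdiv
    have hβu : IsUnit (div β) :=
      (isUnit_pow_iff (PNat.ne_zero _)).mp (IsUnit.of_mul_eq_one _ (by rwa [mul_comm] at hdiv))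
    have hαu : IsUnit (div α) := by
      have h1 := hP.map (pull Φ (inv (baseMap β)))
      rwa [← pull_comp, IsIso.inv_hom_id, pull_id] at h1
    have hnat : (degFr α : ℕ) * (degFr β : ℕ) = p := by exact_mod_cast congrArg PNat.val hdeg
    rcases hp.eq_one_or_self_of_dvd (degFr α : ℕ) (Dvd.intro _ hnat) with hα1 | hαp
    · exact Or.inl (isIso_of_isUnit_div (isGroupLike_of_isUnit hB) α hαu (PNat.coe_eq_one_iff.mp hα1))
    · have hβ1 : (degFr β : ℕ) = 1 := by
        rw [hαp] at hnat
        exact (Nat.mul_right_inj hp.ne_zero).mp (by rw [hnat, mul_one])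
      exact Or.inr (isIso_of_isUnit_div (isGroupLike_of_isUnit hB) β hβu (PNat.coe_eq_one_iff.mp hβ1))

/-- **No square `F_2^X ≫ ι = ψ ≫ κ'` has `ι` irreducible and `ψ` LINEAR with a NON-UNIT zero divisor**: degrees give
`deg κ' = 2·deg ι ≥ 2`, zero divisors give `Div(ι) = Base(ψ)^* Div(κ') · Div(ψ)^{deg κ'}`, which
`isUnit_of_isIrreducibleHom_of_div_eq` forbids. [cite: MochizukiFrdI2008, §0 p.17] -/
theorem isUnit_div_of_powUnitHom_two_comp_eq {X P Q : ModelFrobenioid Φ B DivB} (ψ : X ⟶ P) (κ' : P ⟶ Q)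
    (ι : powObj Φ B DivB 2 X ⟶ Q) (hι : IsIrreducibleHom ι) (hψ : degFr ψ = 1)
    (hsq : powUnitHom Φ B DivB 2 X ≫ ι = ψ ≫ κ') : IsUnit (div ψ) := by
  have hdeg : degFr ι * 2 = degFr κ' * degFr ψ := congrArg degFr hsq
  rw [hψ, mul_one] at hdeg
  have hn : 2 ≤ (degFr κ' : ℕ) := by
    rw [← hdeg, PNat.mul_coe, show ((2 : ℕ+) : ℕ) = 2 from rfl]
    have h1 := (degFr ι).pos
    omega
  have hdiv : pull Φ (𝟙 X.base) (div ι :) * (1 : (Φ.obj (op X.base) : Type w)) ^ (degFr ι : ℕ) =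
      pull Φ (baseMap ψ) (div κ' :) * div ψ ^ (degFr κ' : ℕ) := congrArg div hsq
  rw [pull_id, one_pow, mul_one] at hdiv
  exact isUnit_of_isIrreducibleHom_of_div_eq hι hn hdiv

end ModelFrobenioid

end Literature.AlgebraicGeometry.Frobenioids

/-! ## §2 The row over the typed Def. 3.6 interface: the degree half for every record -/

namespace Literature.AnabelianGeometry.EtaleTheta

open CategoryTheory Opposite Literature.AlgebraicGeometry.Frobenioids
open ModelFrobenioid (powUnitHom powObj powHom degFr baseMap)

universe u₀ v₀ u v w

variable {D₀ : Type u₀} [Category.{v₀} D₀] {V : FrdIMonoidStub.{w}}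
  {T : RealifiedDivisorMonoids (D₀ := D₀) V} {D : Type u} [Category.{v} D] {VD : FrdICatStub.{u, v, w} D}

section Rows

variable {D₀' : Type u₀} [Category.{v₀} D₀'] {T' : RealifiedDivisorMonoids (D₀ := D₀') V}
  {D' : Type u} [Category.{v} D'] {VD' : FrdICatStub.{u, v, w} D'}
  {C₁ : TemperedFrobenioid T D VD} {C₂ : TemperedFrobenioid T' D' VD'}

namespace TemperedFrobenioid

/-- For every typed tempered Frobenioid, the pure Frobenius morphism of prime degree `p` out of any object is
irreducible (`D` is totally epimorphic and `B = B₀^Λ|_D ×_{(Φ^{ℝ-log})^gp} Φ^gp` is group-like, Def. 3.6 (i)/(ii)).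
[cite: MochizukiEtTh2009, Def 3.6 p.77] -/
theorem isIrreducibleHom_powUnitHom (C : TemperedFrobenioid T D VD) (X : C.category) {p : ℕ+}
    (hp : (p : ℕ).Prime) :
    IsIrreducibleHom (ModelFrobenioid.powUnitHom C.divisorMonoid C.ratFnFunctor C.divBNatTrans p X) :=
  ModelFrobenioid.isIrreducibleHom_powUnitHom (fun _ b => C.isUnit_ratFn (T.isUnit_BΛ _) b)
    C.isTotallyEpimorphic X hp

/-- **Row C38-L02a / F-2809, DEGREE HALF, for EVERY equivalence**: for any equivalence `e : C₁ ⥲ C₂` of the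
Frobenioids of two typed tempered Frobenioids and any pre-step `φ` of `C₁`, `e φ` is LINEAR.  (If
`p | deg_Fr(e φ)` is prime, `ψ := η_X ≫ e⁻¹(F_p)` is an irreducible pre-step of `C₁`, hence has a non-unit zero
divisor `x`; transporting the naturality square of `F_p` at `e(F_2^X)` gives `F_2^X ≫ ι = ψ ≫ κ'` in `C₁` with `ι`
irreducible and `deg κ' = 2·deg ι`, so `Div(ι) = Base(ψ)^*Div(κ') · x^{deg κ'}` with exponent `≥ 2` —
impossible for an irreducible arrow.) [cite: MochizukiEtTh2009, Cor 3.8 p.81] -/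
theorem isLinear_map_of_isPreStep (e : C₁.category ≌ C₂.category) {X Y : C₁.category} (φ : X ⟶ Y)
    (hφ : C₁.opsData.IsPreStep φ) : C₂.opsData.IsLinear (e.functor.map φ) := by
  change degFr (e.functor.map φ) = 1
  by_contra hne
  have hB₁ : ∀ (A : Dᵒᵖ) (b : (C₁.ratFnFunctor.obj A : Type w)), IsUnit b := fun _ b => C₁.isUnit_ratFn (T.isUnit_BΛ _) b
  -- a prime factor `p` of `d := deg_Fr(e φ)`
  obtain ⟨p, hp, q, hq⟩ := Nat.exists_prime_and_dvd (n := (degFr (e.functor.map φ) : ℕ))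
    (fun h => hne (PNat.coe_eq_one_iff.mp h))
  have hq0 : 0 < q := Nat.pos_of_ne_zero (by rintro rfl; rw [mul_zero] at hq; exact PNat.ne_zero _ hq)
  let p' : ℕ+ := ⟨p, hp.pos⟩
  have hpq : degFr (e.functor.map φ) = p' * ⟨q, hq0⟩ := PNat.eq hq
  -- Frobenius factorisation `e φ = F_p ≫ ρ'` in `C₂`; pulled back, `φ = ψ ≫ ρ` with `e ψ = F_p ≫ (iso)`
  obtain ⟨ρ', -, hρ'⟩ := ModelFrobenioid.exists_powUnitHom_comp_eq_of_eq_mul (e.functor.map φ) hpq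
  obtain ⟨ψ, hψ⟩ := exists_preimage_from e
    (powUnitHom C₂.divisorMonoid C₂.ratFnFunctor C₂.divBNatTrans p' (e.functor.obj X))
  obtain ⟨ρ, hρ⟩ := exists_preimage_to e ρ'
  have hfac : ψ ≫ ρ = φ := e.functor.map_injective (by
    rw [Functor.map_comp, hψ, hρ, Category.assoc, Iso.inv_hom_id_assoc, hρ'])
  -- `ψ` is an irreducible pre-step of `C₁`
  obtain ⟨hψd, hψb⟩ := (C₁.opsData_isPreStep_iff ψ).1 (C₁.opsData_isPreStep_of_comp_left ψ ρ (hfac ▸ hφ))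
  have hψirr : IsIrreducibleHom ψ := IsIrreducibleHom.of_map e.functor (by
    rw [hψ]
    exact (C₂.isIrreducibleHom_powUnitHom _ (p := p') hp).comp_isIso_right _)
  -- the naturality square of `F_p` at `e(F_2^X)`, pulled back to `C₁`: `F_2^X ≫ ι = ψ ≫ κ'`, `ι` irreducible
  obtain ⟨ι, hι⟩ := exists_preimage_from e (powUnitHom C₂.divisorMonoid C₂.ratFnFunctor C₂.divBNatTrans p'
    (e.functor.obj (powObj C₁.divisorMonoid C₁.ratFnFunctor C₁.divBNatTrans 2 X)))
  have hιirr : IsIrreducibleHom ι := IsIrreducibleHom.of_map e.functor (by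
    rw [hι]
    exact (C₂.isIrreducibleHom_powUnitHom _ (p := p') hp).comp_isIso_right _)
  obtain ⟨κ', hκ'⟩ : ∃ κ' : e.functor.objPreimage (powObj C₂.divisorMonoid C₂.ratFnFunctor C₂.divBNatTrans p'
        (e.functor.obj X)) ⟶ e.functor.objPreimage (powObj C₂.divisorMonoid C₂.ratFnFunctor C₂.divBNatTrans p'
        (e.functor.obj (powObj C₁.divisorMonoid C₁.ratFnFunctor C₁.divBNatTrans 2 X))),
      e.functor.map κ' = (e.functor.objObjPreimageIso _).hom ≫
        powHom p' (e.functor.map (powUnitHom C₁.divisorMonoid C₁.ratFnFunctor C₁.divBNatTrans 2 X)) ≫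
          (e.functor.objObjPreimageIso _).inv :=
    ⟨e.functor.preimage _, e.functor.map_preimage _⟩
  have hnat := ModelFrobenioid.powUnitHom_comp_powHom C₂.divisorMonoid C₂.ratFnFunctor C₂.divBNatTrans p'
    (e.functor.map (powUnitHom C₁.divisorMonoid C₁.ratFnFunctor C₁.divBNatTrans 2 X))
  have hsq : powUnitHom C₁.divisorMonoid C₁.ratFnFunctor C₁.divBNatTrans 2 X ≫ ι = ψ ≫ κ' :=
    e.functor.map_injective (by
      simp only [Functor.map_comp, hι, hψ, hκ', Category.assoc, Iso.inv_hom_id_assoc]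
      rw [← Category.assoc, ← Category.assoc, hnat])
  -- the zero divisor of `ψ` is a non-unit (irreducible, not an isomorphism), yet the square makes it a unit
  refine hψirr.1 ?_
  haveI := hψb
  exact ModelFrobenioid.isIso_of_isUnit_div (ModelFrobenioid.isGroupLike_of_isUnit hB₁) ψ
    (ModelFrobenioid.isUnit_div_of_powUnitHom_two_comp_eq ψ κ' ι hιirr hψd hsq) hψd

/-- The mirror statement for `e⁻¹`: `e⁻¹ φ` is linear for every pre-step `φ` of `C₂`. [cite: MochizukiEtTh2009, Cor 3.8 p.81] -/
theorem isLinear_inverse_map_of_isPreStep (e : C₁.category ≌ C₂.category) {X Y : C₂.category} (φ : X ⟶ Y)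
    (hφ : C₂.opsData.IsPreStep φ) : C₁.opsData.IsLinear (e.inverse.map φ) :=
  isLinear_map_of_isPreStep e.symm φ hφ

end TemperedFrobenioid

namespace Cor38Hyp

variable (h : Cor38Hyp C₁ C₂)

/-- **Row C38-L02a / F-2809, DEGREE HALF, for EVERY record `h : Cor38Hyp C₁ C₂`**: `Ψ` carries every pre-step of
`C₁` to a LINEAR morphism of `C₂` — no hypothesis on the data, no [FrdI] Thm. 3.4 input, no use of `h.fsmff` or of
the non-dilating clauses. [cite: MochizukiEtTh2009, Cor 3.8 p.81] -/
theorem isLinear_map_of_isPreStep {X Y : C₁.category} (φ : X ⟶ Y) (hφ : C₁.opsData.IsPreStep φ) :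
    C₂.opsData.IsLinear (h.Ψ.functor.map φ) :=
  TemperedFrobenioid.isLinear_map_of_isPreStep h.Ψ φ hφ

/-- The mirror for `Ψ⁻¹`: `Ψ⁻¹` carries every pre-step of `C₂` to a linear morphism of `C₁`.
[cite: MochizukiEtTh2009, Cor 3.8 p.81] -/
theorem isLinear_inverse_map_of_isPreStep {X Y : C₂.category} (φ : X ⟶ Y) (hφ : C₂.opsData.IsPreStep φ) :
    C₁.opsData.IsLinear (h.Ψ.inverse.map φ) :=
  TemperedFrobenioid.isLinear_inverse_map_of_isPreStep h.Ψ φ hφ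

/-- **Structural closer of row C38-L02a (F-2809) with NO degree hypothesis**: if in `D₁`, `D₂` every
fiberwise-surjective arrow is invertible (points, groupoids, `SingleObj Aff⁺(ℤ)`, `SingleObj` of a free monoid, …),
then `Ψ` preserves pre-steps — abc-iut-w6-d057's closer with its F-2815 hypothesis `PreservesLinear` DISCHARGED on
pre-steps by `isLinear_map_of_isPreStep`. [cite: MochizukiEtTh2009, Cor 3.8 p.81] -/
theorem preservesPreSteps_of_isIso_of_isFiberwiseSurjective
    (hD : ∀ ⦃a b : D⦄ (g : a ⟶ b), IsFiberwiseSurjective g → IsIso g)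
    (hD' : ∀ ⦃a b : D'⦄ (g : a ⟶ b), IsFiberwiseSurjective g → IsIso g) : h.PreservesPreSteps :=
  ⟨fun _ _ φ hφ => ⟨h.isLinear_map_of_isPreStep φ hφ,
      hD' _ (h.isFiberwiseSurjective_baseMap_map_of_isPreStep φ hφ)⟩,
    fun _ _ φ hφ => ⟨h.isLinear_inverse_map_of_isPreStep φ hφ,
      hD _ (h.isFiberwiseSurjective_baseMap_inverse_map_of_isPreStep φ hφ)⟩⟩

/-- **Row C38-L02a / F-2809 HOLDS FOR EVERY RECORD OVER DISCRETE BASES** (all the `Discrete PUnit`-based data of the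
tree, any discrete `D₁`, `D₂`): abc-iut-w6-d057's `preservesPreSteps_of_preservesLinear_of_isDiscrete` with its
hypothesis `hL : h.PreservesLinear` discharged. [cite: MochizukiEtTh2009, Cor 3.8 p.81] -/
theorem preservesPreSteps_of_isDiscrete [IsDiscrete D] [IsDiscrete D'] : h.PreservesPreSteps :=
  h.preservesPreSteps_of_isIso_of_isFiberwiseSurjective (fun _ _ _ _ => inferInstance)
    (fun _ _ _ _ => inferInstance)

/-- **Row C38-L02a / F-2809 for every record over one-object bases all of whose arrows are monomorphisms** (e.g.
`SingleObj` of a left-cancellative monoid of FSMFF-type), USING `h.fsmff`: `Base(Ψ φ)` of a pre-step is an FSM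
endomorphism of a category of FSMFF-type, hence invertible ([FrdI] §0 p. 18) — abc-iut-w6-d057's
`preservesPreSteps_of_preservesLinear_of_subsingleton` with `hL` discharged. [cite: MochizukiEtTh2009, Cor 3.8 p.81] -/
theorem preservesPreSteps_of_subsingleton_of_mono [Subsingleton D] [Subsingleton D']
    (hm : ∀ ⦃a b : D⦄ (g : a ⟶ b), Mono g) (hm' : ∀ ⦃a b : D'⦄ (g : a ⟶ b), Mono g) : h.PreservesPreSteps := by
  refine h.preservesPreSteps_of_isIso_of_isFiberwiseSurjective (fun a b g hg => ?_) (fun a b g hg => ?_)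
  · obtain rfl : a = b := Subsingleton.elim a b
    exact h.fsmff.1.isIso_of_isFSM_of_isEndomorphism g ⟨hg, hm g⟩
  · obtain rfl : a = b := Subsingleton.elim a b
    exact h.fsmff.2.isIso_of_isFSM_of_isEndomorphism g ⟨hg, hm' g⟩

/-- **Row C38-L02a / F-2809 for every record over bases of FSM-type with cancellative divisor monoids** ([FrdI] §0
p. 14: every FSM arrow invertible — points, groupoids, one-object bases of FSMFF-type all of whose arrows are monic):
the image of a pre-step is linear (this file), so its base is fiberwise-surjective (abc-iut-w6-d057) and monic
(abc-iut-w6-d079's degree-one mono descent), i.e. FSM, hence invertible — abc-iut-w6-d040's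
`preservesPreSteps_of_powerObstruction_of_isOfFSMType` with its power-obstruction hypotheses discharged.
[cite: MochizukiEtTh2009, Cor 3.8 p.81] -/
theorem preservesPreSteps_of_isOfFSMType (hD : IsOfFSMType D) (hD' : IsOfFSMType D')
    (hΦ₁ : ∀ (A : Dᵒᵖ) (x y z : C₁.Φ.carrier A), x * y = x * z → y = z)
    (hΦ₂ : ∀ (A : D'ᵒᵖ) (x y z : C₂.Φ.carrier A), x * y = x * z → y = z) : h.PreservesPreSteps := by
  refine ⟨fun X Y φ hφ => ?_, fun X Y φ hφ => ?_⟩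
  · have hlin := h.isLinear_map_of_isPreStep φ hφ
    exact ⟨hlin, hD'.isIso_of_isFSM _ (h.isFSM_baseMap_map_of_isPreStep_of_isLinear hΦ₁ φ hφ hlin)⟩
  · have hlin := h.isLinear_inverse_map_of_isPreStep φ hφ
    have hφ' := (C₂.opsData_isPreStep_iff φ).1 hφ
    haveI : IsIso (ModelFrobenioid.baseMap φ) := hφ'.2
    haveI : Mono φ := C₂.mono_of_degFr_eq_one hΦ₂ φ hφ'.1
    haveI : Mono (h.Ψ.inverse.map φ) := h.mono_inverse_map_of_mono φ
    exact ⟨hlin, hD.isIso_of_isFSM _ ⟨h.isFiberwiseSurjective_baseMap_inverse_map_of_isPreStep φ hφ,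
      ModelFrobenioid.mono_baseMap_of_mono_of_degFr_eq_one _ hlin⟩⟩

end Cor38Hyp

end Rows

end Literature.AnabelianGeometry.EtaleTheta
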